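import Literature.AlgebraicGeometry.Frobenioids.MotivatingExamplesThm64ivFieldIso
import Mathlib.FieldTheory.Normal.Basic
import Mathlib.Algebra.Algebra.Hom.Rat
import Mathlib.CategoryTheory.EssentialImage
import HarnessLib

/-!
# Frobenioids I, Theorem 6.4 (iv), sub-node T64iv/L07b: compatibility with an isomorphism `F₁ ≅ F₂` —
# REDUCED to `F₁ ≅ F₂`, and DISCHARGED when `F₁` is Galois over `ℚ`

Mochizuki, *The geometry of Frobenioids I: the general theory*, Kyushu J. Math. **62** (2008) 293–400,
Thm. 6.4 (iv) p. 115 l. 23–29 [cite: MochizukiFrdI2008, Thm. 6.4 (iv) p.115]: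

> "If, moreover, there exists a finite extension `L₁ ⊆ F̃₁` of `F₁` which is Galois over `ℚ`, then the
> corresponding [i.e., via the equivalence `D₁ ⥲ D₂` induced by `Ψ` — cf. (i); Corollary 4.11, (ii)] finite
> extension `L₂ ⊆ F̃₂` of `F₂` is isomorphic to `L₁` in a fashion that is compatible with an isomorphism
> `F₁ ≅ F₂`."

The printed proof (p. 116 l. 17–35) ends at "`L₁ ⊆ L₂`, hence that `L₁ = L₂`" — row T64iv/L07a,
DISCHARGED by seat abc-iut-w4-d109 (`MotivatingExamplesThm64ivFieldIso.lean`) — and does not argue the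
compatibility with an isomorphism `F₁ ≅ F₂`; that clause is row **T64iv/L07b** of
`plan/L1/SUBDAG-FrdI-Thm64.md`, recorded as GAP-LEDGER G-L1t3-1 (abc-iut-L1-t3) with disposition "keep as a
separately named undischarged sub-statement". PROOF-ONLY companion (seat abc-iut-L1-d4, gen 5; no new
definitions, no named facts), settling the logical status of that clause in the letter of abc-iut-L1-t3's schema
`Thm64iv` (`ArithmeticFrobenioids.lean`):

1. **Reduction (field theory).** For `L₁` Galois over `ℚ`, ANY ring isomorphism `e₁ : L₁ ≅ L₂` and ANY ring
   homomorphism `φ : F₁ → F₂` are realised compatibly: there is `e : L₁ ≅ L₂` with `e ∘ (F₁ → L₁) = (F₂ → L₂) ∘ φ`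
   (extend the `ℚ`-embedding `e₁⁻¹ ∘ (F₂ → L₂) ∘ φ : F₁ → L₁` to an automorphism of the normal extension `L₁/ℚ`;
   `exists_ringEquiv_compat_of_ringHom`). Hence the compatibility clause of Thm. 6.4 (iv) at `X = Spec L₁` is
   EQUIVALENT to `L07a(X) ∧ Nonempty (F₁ ≃+* F₂)` (`exists_compat_iff`, `Thm64iv_compat_iff`): its content
   beyond the printed proof is exactly "`F₁ ≅ F₂` as fields".
2. **`Ψ^Base` fixes the base field.** The `1`-unique square of Cor. 4.11 (ii) makes `Ψ^Base : D₁ ⥤ D₂` an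
   equivalence (`PreFrobenioidData.OneUniqueSquare`, first conjunct), so `Ψ^Base(Spec F₁)` receives a morphism
   from `Spec F₂`, i.e. its field is `F₂`-isomorphic to `F₂` (`FinSubextCat.nonempty_algEquiv_obj_of_algEquiv`;
   "`Spec F₁`" = any object `B₁` of `D₁` with `B₁.L ≅ F₁` over `F₁`, e.g. `⟨⊥⟩` via `IntermediateField.botEquiv`;
   such an object is terminal: `FinSubextCat.hom_unique_of_algEquiv`).
3. **Discharge when `F₁/ℚ` is Galois** (covers `F₁ = ℚ`): print's own transport argument (T64iv/L07a) applied at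
   `X = Spec F₁` gives `F₁ ≅ (Ψ^Base(Spec F₁)).L ≅ F₂` (`nonempty_baseRingEquiv_of_isGalois_of_transport`), whence
   the full clause at every `X` with `X.L` Galois over `ℚ` (`Thm64iv_compat_of_transport_of_isGalois_base`), at the
   same hypothesis level as T64iv/L07a (the residue-characteristic and log-norm transports of Thm. 6.4 (iii)/(iv),
   first clause, which row T64iv/L01 supplies at THE data).
4. **Honest residual.** For `F₁` not Galois over `ℚ` the clause needs `Nonempty (F₁ ≃+* F₂)`
   (`nonempty_baseRingEquiv_of_compat`), which the printed proof does not supply: the transports at `Spec F₁`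
   make `F₁`, `F₂` arithmetically equivalent (same residue characteristics and norms along a bijection of places),
   not isomorphic. Nothing is claimed here about that case beyond the reduction.

Nothing here bears on, or takes a side on, [IUTchIII] Cor. 3.12; no statement of the paper is strengthened.
-/

noncomputable section

namespace Literature.AlgebraicGeometry.Frobenioids

open CategoryTheory NumberField

/-! ### 1. Field theory: inside `L₁` Galois over `ℚ`, every `F₁ → F₂` is realised by some `L₁ ≅ L₂` -/

section FieldTheory

variable {F₁ F₂ L₁ L₂ : Type*} [Field F₁] [Field F₂] [Field L₁] [Field L₂]
  [CharZero F₁] [CharZero L₁] [Algebra F₁ L₁] [Algebra F₂ L₂]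

/-- **"[since `L₁` is Galois over `ℚ`]" — the compatibility is automatic once `F₁ → F₂` is given**: if `L₁/ℚ` is
Galois, `e₁ : L₁ ≅ L₂` is any ring isomorphism and `φ : F₁ → F₂` any ring homomorphism (`F_i ⊆ L_i`), then some
ring isomorphism `e : L₁ ≅ L₂` satisfies `e(a) = φ(a)` on `F₁`: the `ℚ`-embedding `e₁⁻¹ ∘ (F₂ ↪ L₂) ∘ φ` of `F₁`
into the normal extension `L₁/ℚ` extends to an automorphism `σ` of `L₁`, and `e := e₁ ∘ σ` works.
[cite: MochizukiFrdI2008, Thm. 6.4 (iv) p.115] -/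
theorem exists_ringEquiv_compat_of_ringHom [IsGalois ℚ L₁] (e₁ : L₁ ≃+* L₂) (φ : F₁ →+* F₂) :
    ∃ e : L₁ ≃+* L₂, ∀ a : F₁, e (algebraMap F₁ L₁ a) = algebraMap F₂ L₂ (φ a) := by
  haveI : IsScalarTower ℚ F₁ L₁ :=
    IsScalarTower.of_algebraMap_eq fun q => ((algebraMap F₁ L₁).map_rat_algebraMap q).symm
  -- the `ℚ`-embedding `j := e₁⁻¹ ∘ (F₂ → L₂) ∘ φ : F₁ → L₁`
  let j : F₁ →ₐ[ℚ] L₁ := (e₁.symm.toRingHom.comp ((algebraMap F₂ L₂).comp φ)).toRatAlgHom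
  have hj : ∀ a : F₁, j a = e₁.symm (algebraMap F₂ L₂ (φ a)) := fun _ => rfl
  -- extend `j` to an endomorphism `σ` of the normal extension `L₁/ℚ`; it is an automorphism
  let σ : L₁ →ₐ[ℚ] L₁ := j.liftNormal L₁
  have hσ : ∀ a : F₁, σ (algebraMap F₁ L₁ a) = j a := fun a =>
    (j.liftNormal_commutes L₁ a).trans (Algebra.algebraMap_self_apply _)
  have hbij : Function.Bijective σ := Algebra.IsAlgebraic.algHom_bijective σ
  refine ⟨(AlgEquiv.ofBijective σ hbij).toRingEquiv.trans e₁, fun a => ?_⟩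
  rw [RingEquiv.trans_apply]
  change e₁ (σ (algebraMap F₁ L₁ a)) = _
  rw [hσ, hj, RingEquiv.apply_symm_apply]

/-- The same with an isomorphism `φ : F₁ ≅ F₂` of base fields (the shape of the clause in `Thm64iv`).
[cite: MochizukiFrdI2008, Thm. 6.4 (iv) p.115] -/
theorem exists_ringEquiv_compat_of_ringEquiv [IsGalois ℚ L₁] (e₁ : L₁ ≃+* L₂) (φ : F₁ ≃+* F₂) :
    ∃ (e : L₁ ≃+* L₂) (e₀ : F₁ ≃+* F₂), ∀ a : F₁, e (algebraMap F₁ L₁ a) = algebraMap F₂ L₂ (e₀ a) := by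
  obtain ⟨e, he⟩ := exists_ringEquiv_compat_of_ringHom (L₁ := L₁) (L₂ := L₂) e₁ φ.toRingHom
  exact ⟨e, φ, he⟩

/-- **The reduction**: for `L₁` Galois over `ℚ`, "`L₂ ≅ L₁` compatibly with an isomorphism `F₁ ≅ F₂`" holds iff
`L₁ ≅ L₂` AND `F₁ ≅ F₂` as fields — the compatibility itself carries no further content.
[cite: MochizukiFrdI2008, Thm. 6.4 (iv) p.115] -/
theorem exists_compat_iff [IsGalois ℚ L₁] :
    (∃ (e : L₁ ≃+* L₂) (e₀ : F₁ ≃+* F₂), ∀ a : F₁, e (algebraMap F₁ L₁ a) = algebraMap F₂ L₂ (e₀ a)) ↔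
      Nonempty (L₁ ≃+* L₂) ∧ Nonempty (F₁ ≃+* F₂) := by
  constructor
  · rintro ⟨e, e₀, -⟩
    exact ⟨⟨e⟩, ⟨e₀⟩⟩
  · rintro ⟨⟨e₁⟩, ⟨φ⟩⟩
    exact exists_ringEquiv_compat_of_ringEquiv e₁ φ

end FieldTheory

/-! ### 2. `Spec F` is terminal in `D = B(Gal(K/F))⁰`, and an equivalence `Ψ^Base` respects it

"`Spec F`" is any object `B` of `D` whose field is `F`-isomorphic to `F` (witness `ε : B.L ≃ₐ[F] F`), e.g. the
object `⟨⊥⟩` with `IntermediateField.botEquiv F K`. -/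

namespace FinSubextCat

section Terminal

variable {F : Type} [Field F] {K : Type} [Field K] [Algebra F K]

/-- Every object `Spec L` of `D` maps to `Spec F` (the structure map `F → L`).
[cite: MochizukiFrdI2008, Ex. 6.3 p.113] -/
theorem nonempty_hom_of_algEquiv (B : FinSubextCat F K) (ε : B.L ≃ₐ[F] F) (X : FinSubextCat F K) :
    Nonempty (X ⟶ B) :=
  ⟨⟨(Algebra.ofId F X.L).comp (ε : B.L →ₐ[F] F)⟩⟩

/-- In particular every object maps to `⟨⊥⟩` (the inclusion `⊥ ⊆ L`). [cite: MochizukiFrdI2008, Ex. 6.3 p.113] -/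
theorem nonempty_hom_bot (X : FinSubextCat F K) : Nonempty (X ⟶ (⟨⊥⟩ : FinSubextCat F K)) :=
  ⟨⟨IntermediateField.inclusion bot_le⟩⟩

/-- `Spec F` is terminal in `D`: a morphism `Spec L → Spec F`, i.e. an `F`-algebra map `B.L → L` with
`B.L ≅ F`, is unique (every element of `B.L` is an `algebraMap F`-image). [cite: MochizukiFrdI2008, Ex. 6.3 p.113] -/
theorem hom_unique_of_algEquiv (B : FinSubextCat F K) (ε : B.L ≃ₐ[F] F) (X : FinSubextCat F K)
    (f g : X ⟶ B) : f = g := by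
  refine hom_ext (AlgHom.ext fun x => ?_)
  have hx : x = algebraMap F B.L (ε x) := by
    apply ε.injective
    rw [AlgEquiv.commutes, Algebra.algebraMap_self_apply]
  rw [hx, AlgHom.commutes, AlgHom.commutes]

/-- `⟨⊥⟩` is terminal in `D`. [cite: MochizukiFrdI2008, Ex. 6.3 p.113] -/
theorem hom_bot_unique (X : FinSubextCat F K) (f g : X ⟶ (⟨⊥⟩ : FinSubextCat F K)) : f = g :=
  hom_unique_of_algEquiv ⟨⊥⟩ (IntermediateField.botEquiv F K) X f g

/-- An `F`-algebra map from the field of an object `T = Spec M` of `D` to a copy `B.L ≅ F` of the base field is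
bijective (injective as a map of fields; surjective because it is the identity on `F`).
[cite: MochizukiFrdI2008, Ex. 6.3 p.113] -/
theorem algHom_bijective_of_algEquiv (B : FinSubextCat F K) (ε : B.L ≃ₐ[F] F) (T : FinSubextCat F K)
    (g : T.L →ₐ[F] B.L) : Function.Bijective g := by
  refine ⟨g.toRingHom.injective, fun y => ⟨algebraMap F T.L (ε y), ?_⟩⟩
  rw [AlgHom.commutes]
  apply ε.injective
  rw [AlgEquiv.commutes, Algebra.algebraMap_self_apply]

/-- A morphism `Spec F → Spec M` in `D` forces `M ≅ F` over `F`. [cite: MochizukiFrdI2008, Ex. 6.3 p.113] -/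
theorem nonempty_algEquiv_of_hom_from (B : FinSubextCat F K) (ε : B.L ≃ₐ[F] F) (T : FinSubextCat F K)
    (f : B ⟶ T) : Nonempty (T.L ≃ₐ[F] F) :=
  ⟨(AlgEquiv.ofBijective f.toAlgHom (algHom_bijective_of_algEquiv B ε T f.toAlgHom)).trans ε⟩

end Terminal

section BaseEquivalence

variable {F₁ : Type} [Field F₁] {K₁ : Type} [Field K₁] [Algebra F₁ K₁]
variable {F₂ : Type} [Field F₂] {K₂ : Type} [Field K₂] [Algebra F₂ K₂]

/-- If `Ψ^Base : D₁ ⥤ D₂` is an equivalence (Cor. 4.11 (ii)), `Ψ^Base(Spec F₁)` receives a morphism from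
`Spec F₂ = ⟨⊥⟩`: pick `Z` with `Ψ^Base(Z) ≅ Spec F₂` and push `Z → Spec F₁` forward.
[cite: MochizukiFrdI2008, Thm. 6.4 (iv) p.115] -/
theorem nonempty_hom_bot_obj_of_algEquiv (ΨBase : FinSubextCat F₁ K₁ ⥤ FinSubextCat F₂ K₂)
    [ΨBase.IsEquivalence] (B₁ : FinSubextCat F₁ K₁) (ε₁ : B₁.L ≃ₐ[F₁] F₁) :
    Nonempty ((⟨⊥⟩ : FinSubextCat F₂ K₂) ⟶ ΨBase.obj B₁) :=
  ⟨(ΨBase.objObjPreimageIso ⟨⊥⟩).inv ≫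
    ΨBase.map (Classical.choice (nonempty_hom_of_algEquiv B₁ ε₁ (ΨBase.objPreimage ⟨⊥⟩)))⟩

/-- **`Ψ^Base` respects the base field**: for an equivalence `Ψ^Base : D₁ ⥤ D₂`, the field of
`Ψ^Base(Spec F₁)` is `F₂`-isomorphic to `F₂` (i.e. `Ψ^Base(Spec F₁) ≅ Spec F₂`, the terminal object).
[cite: MochizukiFrdI2008, Thm. 6.4 (iv) p.115] -/
theorem nonempty_algEquiv_obj_of_algEquiv (ΨBase : FinSubextCat F₁ K₁ ⥤ FinSubextCat F₂ K₂)
    [ΨBase.IsEquivalence] (B₁ : FinSubextCat F₁ K₁) (ε₁ : B₁.L ≃ₐ[F₁] F₁) :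
    Nonempty ((ΨBase.obj B₁).L ≃ₐ[F₂] F₂) := by
  obtain ⟨f⟩ := nonempty_hom_bot_obj_of_algEquiv ΨBase B₁ ε₁
  exact nonempty_algEquiv_of_hom_from ⟨⊥⟩ (IntermediateField.botEquiv F₂ K₂) _ f

/-- The letter of abc-iut-L1-t3's hypothesis: a `1`-unique square (`PreFrobenioidData.OneUniqueSquare`, as in
`Thm64iv`) has an equivalence as its base functor. [cite: MochizukiFrdI2008, Cor. 4.11 (ii) p.92] -/
theorem isEquivalence_of_oneUniqueSquare {X₁ : Type*} [Category X₁] {X₂ : Type*} [Category X₂]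
    (T : X₁ ⥤ X₂) (L : X₁ ⥤ FinSubextCat F₁ K₁) (R : X₂ ⥤ FinSubextCat F₂ K₂)
    (ΨBase : FinSubextCat F₁ K₁ ⥤ FinSubextCat F₂ K₂)
    (h : PreFrobenioidData.OneUniqueSquare T L R ΨBase) : ΨBase.IsEquivalence :=
  h.1

end BaseEquivalence

end FinSubextCat

/-! ### 3. The clause in the letter of the schema `Thm64iv`; `F₁` Galois over `ℚ` -/

section Schema

variable {F₁ : Type} [Field F₁] {K₁ : Type} [Field K₁] [Algebra F₁ K₁]
variable {F₂ : Type} [Field F₂] {K₂ : Type} [Field K₂] [Algebra F₂ K₂]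

/-- The residual isolated: the compatibility clause of `Thm64iv` at any `X` yields `F₁ ≅ F₂`.
[cite: MochizukiFrdI2008, Thm. 6.4 (iv) p.115] -/
theorem nonempty_baseRingEquiv_of_compat (ΨBase : FinSubextCat F₁ K₁ ⥤ FinSubextCat F₂ K₂)
    (X : FinSubextCat F₁ K₁)
    (h : ∃ (e : X.L ≃+* (ΨBase.obj X).L) (e₀ : F₁ ≃+* F₂),
      ∀ a : F₁, e (algebraMap F₁ X.L a) = algebraMap F₂ (ΨBase.obj X).L (e₀ a)) :
    Nonempty (F₁ ≃+* F₂) := by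
  obtain ⟨-, e₀, -⟩ := h
  exact ⟨e₀⟩

variable [NumberField F₁]

/-- **T64iv/L07b ⇐ T64iv/L07a + `F₁ ≅ F₂`**: for `X = Spec L₁` with `L₁` Galois over `ℚ`, any field isomorphism
`X.L ≅ (Ψ^Base X).L` and any `F₁ ≅ F₂` can be replaced by a COMPATIBLE pair — the conclusion of the second
clause of `Thm64iv` at `X`. [cite: MochizukiFrdI2008, Thm. 6.4 (iv) p.115] -/
theorem Thm64iv_compat_of_fieldIso_of_baseIso (ΨBase : FinSubextCat F₁ K₁ ⥤ FinSubextCat F₂ K₂)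
    (X : FinSubextCat F₁ K₁) (hX : IsGalois ℚ X.L) (e₁ : X.L ≃+* (ΨBase.obj X).L) (φ : F₁ ≃+* F₂) :
    ∃ (e : X.L ≃+* (ΨBase.obj X).L) (e₀ : F₁ ≃+* F₂),
      ∀ a : F₁, e (algebraMap F₁ X.L a) = algebraMap F₂ (ΨBase.obj X).L (e₀ a) := by
  haveI := hX
  exact exists_ringEquiv_compat_of_ringEquiv e₁ φ

/-- **The status of T64iv/L07b, kernel-checked**: at `X = Spec L₁` with `L₁` Galois over `ℚ`, the compatibility
clause of Thm. 6.4 (iv) holds iff T64iv/L07a holds at `X` AND `F₁ ≅ F₂` — so GAP G-L1t3-1's content beyond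
the printed proof is exactly `Nonempty (F₁ ≃+* F₂)`. [cite: MochizukiFrdI2008, Thm. 6.4 (iv) p.115] -/
theorem Thm64iv_compat_iff (ΨBase : FinSubextCat F₁ K₁ ⥤ FinSubextCat F₂ K₂)
    (X : FinSubextCat F₁ K₁) (hX : IsGalois ℚ X.L) :
    (∃ (e : X.L ≃+* (ΨBase.obj X).L) (e₀ : F₁ ≃+* F₂),
        ∀ a : F₁, e (algebraMap F₁ X.L a) = algebraMap F₂ (ΨBase.obj X).L (e₀ a)) ↔
      Nonempty (X.L ≃+* (ΨBase.obj X).L) ∧ Nonempty (F₁ ≃+* F₂) := by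
  haveI := hX
  exact exists_compat_iff

/-- The field of "`Spec F₁`" (`B₁.L ≅ F₁`) is Galois over `ℚ` when `F₁` is.
[cite: MochizukiFrdI2008, Thm. 6.4 (iv) p.115] -/
theorem isGalois_rat_of_algEquiv [IsGalois ℚ F₁] (B₁ : FinSubextCat F₁ K₁) (ε₁ : B₁.L ≃ₐ[F₁] F₁) :
    IsGalois ℚ B₁.L := by
  let e : F₁ ≃ₐ[ℚ] B₁.L :=
    AlgEquiv.ofRingEquiv (f := ε₁.symm.toRingEquiv) fun q => by
      change ε₁.symm (algebraMap ℚ F₁ q) = _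
      exact (ε₁.symm : F₁ →+* B₁.L).map_rat_algebraMap q
  exact IsGalois.of_algEquiv e

variable [NumberField F₂]

/-- **`F₁ ≅ F₂` when `F₁` is Galois over `ℚ`**: with `Ψ^Base` an equivalence and the transports of Thm. 6.4
(iii)/(iv) (residue characteristics; log-norms, `deg(Ψ^rlf) = 1`) at the object `B₁ = Spec F₁` (`B₁.L ≅ F₁`),
T64iv/L07a at `X = Spec F₁` (abc-iut-w4-d109) gives `F₁ ≅ B₁.L ≅ (Ψ^Base B₁).L ≅ F₂`.
[cite: MochizukiFrdI2008, Thm. 6.4 (iv) p.115] -/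
theorem nonempty_baseRingEquiv_of_isGalois_of_transport [IsGalois ℚ F₁]
    (ΨBase : FinSubextCat F₁ K₁ ⥤ FinSubextCat F₂ K₂) [ΨBase.IsEquivalence]
    (B₁ : FinSubextCat F₁ K₁) (ε₁ : B₁.L ≃ₐ[F₁] F₁)
    (π₀ : FinitePlace B₁.L ≃ FinitePlace (ΨBase.obj B₁).L)
    (hπ₀ : ∀ w, residueChar (π₀ w) = residueChar w) (hgen₀ : ∀ w, logNorm w = logNorm (π₀ w)) :
    Nonempty (F₁ ≃+* F₂) := by
  obtain ⟨e⟩ := Thm64iv_fieldIso_of_transport ΨBase B₁ (isGalois_rat_of_algEquiv B₁ ε₁) π₀ hπ₀ hgen₀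
  obtain ⟨e₂⟩ := FinSubextCat.nonempty_algEquiv_obj_of_algEquiv ΨBase B₁ ε₁
  exact ⟨(ε₁.symm.toRingEquiv.trans e).trans e₂.toRingEquiv⟩

/-- **T64iv/L07b ⇐ the transports at `X` + `F₁ ≅ F₂`**: under the hypotheses of abc-iut-w4-d109's
`Thm64iv_fieldIso_of_transport` (T64iv/L07a: `Ψ` induces a residue-characteristic preserving bijection of finite
places at `X` along which, `deg(Ψ^rlf)` being `1`, the norms agree) and an isomorphism `F₁ ≅ F₂`, the second
clause of `Thm64iv` holds at `X`. [cite: MochizukiFrdI2008, Thm. 6.4 (iv) p.115] -/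
theorem Thm64iv_compat_of_transport_of_baseIso (ΨBase : FinSubextCat F₁ K₁ ⥤ FinSubextCat F₂ K₂)
    (X : FinSubextCat F₁ K₁) (hX : IsGalois ℚ X.L)
    (π : FinitePlace X.L ≃ FinitePlace (ΨBase.obj X).L) (hπ : ∀ w, residueChar (π w) = residueChar w)
    (hgen : ∀ w, logNorm w = logNorm (π w)) (φ : F₁ ≃+* F₂) :
    ∃ (e : X.L ≃+* (ΨBase.obj X).L) (e₀ : F₁ ≃+* F₂),
      ∀ a : F₁, e (algebraMap F₁ X.L a) = algebraMap F₂ (ΨBase.obj X).L (e₀ a) := by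
  obtain ⟨e₁⟩ := Thm64iv_fieldIso_of_transport ΨBase X hX π hπ hgen
  exact Thm64iv_compat_of_fieldIso_of_baseIso ΨBase X hX e₁ φ

/-- **T64iv/L07b DISCHARGED when `F₁` is Galois over `ℚ`** (e.g. `F₁ = ℚ`), at the hypothesis level of
T64iv/L07a: `Ψ^Base` an equivalence (Cor. 4.11 (ii), the first conjunct of `PreFrobenioidData.OneUniqueSquare` in
`Thm64iv`), the transports of Thm. 6.4 (iii)/(iv) at `B₁ = Spec F₁` and at `X = Spec L₁` with `L₁` Galois over
`ℚ`; then `L₂ ≅ L₁` compatibly with an isomorphism `F₁ ≅ F₂`. [cite: MochizukiFrdI2008, Thm. 6.4 (iv) p.115] -/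
theorem Thm64iv_compat_of_transport_of_isGalois_base [IsGalois ℚ F₁]
    (ΨBase : FinSubextCat F₁ K₁ ⥤ FinSubextCat F₂ K₂) [ΨBase.IsEquivalence]
    (B₁ : FinSubextCat F₁ K₁) (ε₁ : B₁.L ≃ₐ[F₁] F₁)
    (π₀ : FinitePlace B₁.L ≃ FinitePlace (ΨBase.obj B₁).L)
    (hπ₀ : ∀ w, residueChar (π₀ w) = residueChar w) (hgen₀ : ∀ w, logNorm w = logNorm (π₀ w))
    (X : FinSubextCat F₁ K₁) (hX : IsGalois ℚ X.L)
    (π : FinitePlace X.L ≃ FinitePlace (ΨBase.obj X).L) (hπ : ∀ w, residueChar (π w) = residueChar w)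
    (hgen : ∀ w, logNorm w = logNorm (π w)) :
    ∃ (e : X.L ≃+* (ΨBase.obj X).L) (e₀ : F₁ ≃+* F₂),
      ∀ a : F₁, e (algebraMap F₁ X.L a) = algebraMap F₂ (ΨBase.obj X).L (e₀ a) := by
  obtain ⟨φ⟩ := nonempty_baseRingEquiv_of_isGalois_of_transport ΨBase B₁ ε₁ π₀ hπ₀ hgen₀
  exact Thm64iv_compat_of_transport_of_baseIso ΨBase X hX π hπ hgen φ

/-- The same over the literal `1`-unique-square hypothesis of `Thm64iv` (any categories `C_i` with base functors
to `D_i` and `Ψ : C₁ ⥤ C₂`). [cite: MochizukiFrdI2008, Thm. 6.4 (iv) p.115] -/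
theorem Thm64iv_compat_of_transport_of_isGalois_base' [IsGalois ℚ F₁]
    {C₁ : Type*} [Category C₁] {C₂ : Type*} [Category C₂] (Ψ : C₁ ⥤ C₂)
    (base₁ : C₁ ⥤ FinSubextCat F₁ K₁) (base₂ : C₂ ⥤ FinSubextCat F₂ K₂)
    (ΨBase : FinSubextCat F₁ K₁ ⥤ FinSubextCat F₂ K₂)
    (hsq : PreFrobenioidData.OneUniqueSquare Ψ base₁ base₂ ΨBase)
    (B₁ : FinSubextCat F₁ K₁) (ε₁ : B₁.L ≃ₐ[F₁] F₁)
    (π₀ : FinitePlace B₁.L ≃ FinitePlace (ΨBase.obj B₁).L)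
    (hπ₀ : ∀ w, residueChar (π₀ w) = residueChar w) (hgen₀ : ∀ w, logNorm w = logNorm (π₀ w))
    (X : FinSubextCat F₁ K₁) (hX : IsGalois ℚ X.L)
    (π : FinitePlace X.L ≃ FinitePlace (ΨBase.obj X).L) (hπ : ∀ w, residueChar (π w) = residueChar w)
    (hgen : ∀ w, logNorm w = logNorm (π w)) :
    ∃ (e : X.L ≃+* (ΨBase.obj X).L) (e₀ : F₁ ≃+* F₂),
      ∀ a : F₁, e (algebraMap F₁ X.L a) = algebraMap F₂ (ΨBase.obj X).L (e₀ a) := by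
  haveI := FinSubextCat.isEquivalence_of_oneUniqueSquare Ψ base₁ base₂ ΨBase hsq
  exact Thm64iv_compat_of_transport_of_isGalois_base ΨBase B₁ ε₁ π₀ hπ₀ hgen₀ X hX π hπ hgen

end Schema

end Literature.AlgebraicGeometry.Frobenioids

end
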